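import Mathlib
import Literature.Combinatorics.Enumerative.HigherMultiplicityRestrictions
import HarnessLib

/-!
# `231`-avoiding involutions: `I_n(231) = I_n(312) = 2^{n−1}` (Simion–Schmidt 1985, Proposition 6), and
# `S_n(231, 312)` consists of involutions

Layer `Literature/Combinatorics/Enumerative`, namespace `Literature.Combinatorics.Enumerative.PermContainsPattern` (API of
the tree notion `PermContainsPattern` of `BruhatIntervalRookBoards.lean`; symmetries `PatternAvoidanceSymmetries.lean`,
double restrictions `SimionSchmidtDoubleRestrictions.lean` / `DoubleRestrictionsPowersOfTwo.lean`); lane `lit-hodgefound`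
(Track 2 foundations library; prover seat p13, generation 38, theme «pattern avoidance II: involutions and parity»).

## Source, verbatim

R. Simion, F. W. Schmidt, *Restricted permutations*, European J. Combin. **6** (1985) 383–406 [SimionSchmidt1985]
(open archive, read 2026-08-29; held text `paper:doi-10-1016-s0195-6698-85-80052-4`, pp. 391–392 = chunks p0009–p0010).
§2, after Proposition 5: «Only the restrictions `231` and `312` remain to be investigated; here the results will be
rather different from the previous cases.

> **PROPOSITION 6.** For every `n ≥ 1`, and `p ∈ {231, 312}`, `I_n(p) = 2^{n−1}` and [the numbers of even and odd such
> involutions, through `α = (1 + i√7)/2`, `β = (1 − i√7)/2`].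
> PROOF. Let `σ ∈ S_n(231)` be an involution. Call `i`, `2 ≤ i ≤ n`, the position of an ascent of `σ` iff
> `σ(i) > σ(i − 1)`. To `σ` we associate the set `P_σ ⊆ {2, 3, …, n}` of the positions of its ascents. This map is
> invertible because: (1) the subsequence of ascents is increasing; (2) the only case when `n` is not an ascent is when
> `σ =` the reversal of the identity permutation, in which case `P_σ = ∅`; (3) following `σ(k) = n`, we necessarily have
> the largest letters decreasingly ordered; and (4) if `σ(i) < σ(j)` are consecutive ascents, then `σ(i + 1), σ(i + 2),
> …, σ(j − 1)` are the integers from `i` to `σ(i) − 1` decreasingly ordered. Thus `P_σ` determines the involution `σ`.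
> Hence, `I_n(231) = 2^{n−1}`. … The same results hold for `312`-avoiding involutions.
> REMARKS. A stronger relation holds between `231`- and `312`-avoiding involutions. As known from Lemma 1, if `σ`
> avoids `p`, then `σ⁻¹` avoids `p⁻¹`. Here we have `(3,1,2)⁻¹ = (2,3,1)`, and `σ = σ⁻¹`, since we consider involutions
> only. Thus, `312`- and `231`-avoiding involutions are not only equal in number, but they are equal as sets.

(Here `I_n(R)` = the number of involutions in `S_n(R)`, p. 384.) §3, Proposition 8 and Lemma 5 (b) (in the tree:
`card_av231_av312`, file `DoubleRestrictionsPowersOfTwo.lean`): `A_n(231, 312) = A_n(132, 213) = 2^{n−1}` (Rotem).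

## Formalisation

Involutions are the `v : Perm (Fin n)` with `v * v = 1` (as in `InvolutionsRestrictedBell.lean`); `I_n(231)` is
`Nat.card {v // v * v = 1 ∧ ¬ C v 231}`.  We prove the count of Proposition 6 through the REMARK and §3 rather than
through the ascent sets: (§1) `312 = 231⁻¹`, so `v⁻¹` contains `231` iff `v` contains `312` (`contains_231_inv_iff`,
`contains_312_inv_iff`, from the tree's inverse symmetry `inverse_iff` at `q = finRotate 3`); hence an involution avoiding
`231` avoids `312` and conversely (`not_contains_312_of_involution`, `not_contains_231_of_involution`).  (§2) Conversely —
the description (1)–(4) of the printed proof, in invariant form — ★ every permutation avoiding both `231` and `312` IS an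
involution (`apply_apply_eq_of_av231_av312`, `mul_self_eq_one_of_av231_av312`): if `i < v i =: j` then `v j < j`
(otherwise the `j` values below `j` would occupy positions `< j` other than `i`, since a position `q > j` with `v q < j`
is a `231` at `(i, j, q)` — pigeonhole), and then `v j = i` (if `v j < i`, the values strictly between `v j` and `j` can
only sit strictly between the positions `i` and `j` — a `231` to the left, a `312` to the right — too few positions; if
`v j > i`, the positions strictly between `i` and `j` carry values strictly between `v j` and `j` — too few values); the
case `v i < i` is the case `i < v⁻¹ i` for `v⁻¹`, which avoids the same two patterns.  (§3) Hence
`{involutions avoiding 231} = {involutions avoiding 312} = S_n(231, 312)` as sets (`involution_and_av231_iff`,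
`involution_and_av312_iff`, `setOf_involution_av231_eq`, the REMARK `setOf_involution_av231_eq_setOf_involution_av312`)
and ★★ **PROPOSITION 6** `I_n(231) = I_n(312) = 2^{n−1}` (`card_involutions_av231`, `card_involutions_av312`; also with
`v ^ 2 = 1`).  Not here: the even/odd refinement of Proposition 6 (`α`, `β`), Propositions 3–5 (`I_n(p)` for the other
four patterns, via the Robinson–Schensted correspondence).

Theorems only (no `def`, no instance, no notation, no named fact — net debt 0).
-/

namespace Literature.Combinatorics.Enumerative

namespace PermContainsPattern

open Finset Equiv

variable {n : ℕ}

/-! ### §1 «`(3,1,2)⁻¹ = (2,3,1)`»: inverse symmetry between `231` and `312` -/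

/-- The one-line word of the `3`-cycle `finRotate 3 = (0 ↦ 1, 1 ↦ 2, 2 ↦ 0)` is `1 2 0`, of order type `231`.
[cite: SimionSchmidt1985, §2 Remarks after Proposition 6 (held text p0010)] -/
theorem finRotate_three_word : (fun a : Fin 3 => ((finRotate 3 a : Fin 3) : ℕ)) = ![1, 2, 0] := by
  funext a
  fin_cases a <;> decide

/-- The one-line word of `(finRotate 3)⁻¹ = (0 ↦ 2, 1 ↦ 0, 2 ↦ 1)` is `2 0 1`, of order type `312`:
«`(3,1,2)⁻¹ = (2,3,1)`». [cite: SimionSchmidt1985, §2 Remarks after Proposition 6 (held text p0010)] -/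
theorem finRotate_three_inv_word : (fun a : Fin 3 => (((finRotate 3)⁻¹ a : Fin 3) : ℕ)) = ![2, 0, 1] := by
  funext a
  fin_cases a <;> decide

/-- The word `1 2 0` has the order type of `231`. [cite: SimionSchmidt1985, §1 (held text p0002)] -/
theorem contains_120_iff (v : Perm (Fin n)) :
    PermContainsPattern v ![1, 2, 0] ↔ PermContainsPattern v ![2, 3, 1] :=
  congr_pattern (fun a b => by fin_cases a <;> fin_cases b <;> decide) v

/-- The word `2 0 1` has the order type of `312`. [cite: SimionSchmidt1985, §1 (held text p0002)] -/
theorem contains_201_iff (v : Perm (Fin n)) :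
    PermContainsPattern v ![2, 0, 1] ↔ PermContainsPattern v ![3, 1, 2] :=
  congr_pattern (fun a b => by fin_cases a <;> fin_cases b <;> decide) v

/-- ★ «if `σ` avoids `p`, then `σ⁻¹` avoids `p⁻¹`. Here we have `(3,1,2)⁻¹ = (2,3,1)`»: `v⁻¹` contains `231` iff `v`
contains `312`. [cite: SimionSchmidt1985, Lemma 1 (c) and §2 Remarks after Proposition 6 (held text p0002, p0010)] -/
theorem contains_231_inv_iff (v : Perm (Fin n)) :
    PermContainsPattern v⁻¹ ![2, 3, 1] ↔ PermContainsPattern v ![3, 1, 2] := by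
  have h := inverse_iff v (finRotate 3)⁻¹
  rw [inv_inv, finRotate_three_word, finRotate_three_inv_word, contains_120_iff, contains_201_iff] at h
  exact h

/-- ★ Symmetrically, `v⁻¹` contains `312` iff `v` contains `231`.
[cite: SimionSchmidt1985, Lemma 1 (c) and §2 Remarks after Proposition 6 (held text p0002, p0010)] -/
theorem contains_312_inv_iff (v : Perm (Fin n)) :
    PermContainsPattern v⁻¹ ![3, 1, 2] ↔ PermContainsPattern v ![2, 3, 1] := by
  have h := inverse_iff v (finRotate 3)
  rw [finRotate_three_word, finRotate_three_inv_word, contains_120_iff, contains_201_iff] at h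
  exact h

/-- `v⁻¹` avoids both `231` and `312` iff `v` does: the class `S_n(231, 312)` is closed under inverses.
[cite: SimionSchmidt1985, Lemma 1 (c) (held text p0002)] -/
theorem av231_av312_inv_iff (v : Perm (Fin n)) :
    (¬ PermContainsPattern v⁻¹ ![2, 3, 1] ∧ ¬ PermContainsPattern v⁻¹ ![3, 1, 2]) ↔
      (¬ PermContainsPattern v ![2, 3, 1] ∧ ¬ PermContainsPattern v ![3, 1, 2]) := by
  rw [contains_231_inv_iff, contains_312_inv_iff, and_comm]

/-- An involution is its own inverse. [folklore] -/
private theorem inv_eq_self_of_mul_self {v : Perm (Fin n)} (hv : v * v = 1) : v⁻¹ = v :=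
  (mul_eq_one_iff_inv_eq.mp hv).symm ▸ rfl

/-- «`σ = σ⁻¹`, since we consider involutions only»: an involution avoiding `231` avoids `312`.
[cite: SimionSchmidt1985, §2 Remarks after Proposition 6 (held text p0010)] -/
theorem not_contains_312_of_involution {v : Perm (Fin n)} (hv : v * v = 1) (h : ¬ PermContainsPattern v ![2, 3, 1]) :
    ¬ PermContainsPattern v ![3, 1, 2] := by
  rw [← contains_231_inv_iff, inv_eq_self_of_mul_self hv]
  exact h

/-- And an involution avoiding `312` avoids `231`. [cite: SimionSchmidt1985, §2 Remarks after Proposition 6 (held text p0010)] -/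
theorem not_contains_231_of_involution {v : Perm (Fin n)} (hv : v * v = 1) (h : ¬ PermContainsPattern v ![3, 1, 2]) :
    ¬ PermContainsPattern v ![2, 3, 1] := by
  rw [← contains_312_inv_iff, inv_eq_self_of_mul_self hv]
  exact h

/-! ### §2 Every permutation avoiding `231` and `312` is an involution -/

section Structure

variable {v : Perm (Fin n)}

/-- First step: if `v` avoids `231` and `312` and `i < v i =: j`, then `v j < j`.  (Otherwise `v j > j`; each of the `j`
values `x < j` sits at a position `q = v⁻¹ x ≠ i`, and `q > j` would make `(i, j, q)` a `231`, so `q < j`: `j` values at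
`≤ j − 1` positions.) [cite: SimionSchmidt1985, Proposition 6 (proof, (3)) (held text p0009)] -/
theorem apply_apply_lt_of_lt (h231 : ¬ PermContainsPattern v ![2, 3, 1]) {i : Fin n} (hi : i < v i) :
    v (v i) < v i := by
  set j := v i with hj
  by_contra hcon
  rw [not_lt] at hcon
  have hne : v j ≠ j := fun e => hi.ne (v.injective (e.symm ▸ hj ▸ rfl : v i = v j) ▸ rfl)
  have hlt : j < v j := lt_of_le_of_ne hcon (Ne.symm hne)
  -- every value `x < j` sits at a position `< j` other than `i`
  have hmaps : ∀ x ∈ Finset.Iio j, v.symm x ∈ (Finset.Iio j).erase i := by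
    intro x hx
    rw [Finset.mem_Iio] at hx
    rw [Finset.mem_erase, Finset.mem_Iio]
    have hvq : v (v.symm x) = x := v.apply_symm_apply x
    refine ⟨fun e => ?_, ?_⟩
    · rw [e, ← hj] at hvq
      exact absurd hx (hvq ▸ lt_irrefl j)
    · by_contra hqj
      rw [not_lt] at hqj
      have hqne : v.symm x ≠ j := fun e => by
        rw [e] at hvq
        exact absurd (hvq ▸ hlt) (not_lt.mpr hx.le)
      have hjq : j < v.symm x := lt_of_le_of_ne hqj (Ne.symm hqne)
      exact not231_vals h231 hi hjq ⟨by rw [hvq, ← hj]; exact Fin.lt_def.mp hx, Fin.lt_def.mp hlt⟩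
  have hcard := Finset.card_le_card_of_injOn (fun x => v.symm x) hmaps (v.symm.injective.injOn)
  rw [Finset.card_erase_of_mem (Finset.mem_Iio.mpr hi), Fin.card_Iio] at hcard
  have h0 : (0 : ℕ) < (j : ℕ) := lt_of_le_of_lt (Nat.zero_le _) (Fin.lt_def.mp hi)
  omega

/-- ★ Second step: if `v` avoids `231` and `312` and `i < v i =: j`, then `v j = i` — `i` and `v i` are exchanged.  (By the
first step `l := v j < j`.  If `l < i`, a value strictly between `l` and `j` cannot sit left of `i` (a `231` with `j, l`)
nor right of `j` (a `312` with `j, l`), so the `j − l − 1` such values sit at the `j − i − 1` positions strictly between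
`i` and `j`: too few.  If `l > i`, a position strictly between `i` and `j` cannot carry a value above `j` (a `231`) nor
below `l` (a `312`), so these `j − i − 1` positions carry values strictly between `l` and `j`: too few values.)
[cite: SimionSchmidt1985, Proposition 6 (proof, (3)–(4)) (held text p0009)] -/
theorem apply_apply_eq_of_lt (h231 : ¬ PermContainsPattern v ![2, 3, 1]) (h312 : ¬ PermContainsPattern v ![3, 1, 2])
    {i : Fin n} (hi : i < v i) : v (v i) = i := by
  set j := v i with hj
  have hl : v j < j := apply_apply_lt_of_lt h231 hi
  set l := v j with hlj
  rcases lt_trichotomy l i with hli | hli | hli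
  · -- `l < i`: the values in `(l, j)` sit at positions in `(i, j)`
    exfalso
    have hmaps : ∀ x ∈ Finset.Ioo l j, v.symm x ∈ Finset.Ioo i j := by
      intro x hx
      rw [Finset.mem_Ioo] at hx ⊢
      have hvq : v (v.symm x) = x := v.apply_symm_apply x
      have hqi : v.symm x ≠ i := fun e => by
        rw [e, ← hj] at hvq
        exact absurd hx.2 (hvq ▸ lt_irrefl j)
      have hqj : v.symm x ≠ j := fun e => by
        rw [e, ← hlj] at hvq
        exact absurd hx.1 (hvq ▸ lt_irrefl l)
      constructor
      · by_contra h
        have hqi' : v.symm x < i := lt_of_le_of_ne (not_lt.mp h) hqi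
        exact not231_vals h231 hqi' hi
          ⟨by rw [← hlj, hvq]; exact Fin.lt_def.mp hx.1, by rw [hvq, ← hj]; exact Fin.lt_def.mp hx.2⟩
      · by_contra h
        have hjq : j < v.symm x := lt_of_le_of_ne (not_lt.mp h) (Ne.symm hqj)
        exact not312_vals h312 hi hjq
          ⟨by rw [← hlj, hvq]; exact Fin.lt_def.mp hx.1, by rw [hvq, ← hj]; exact Fin.lt_def.mp hx.2⟩
    have hcard := Finset.card_le_card_of_injOn (fun x => v.symm x) hmaps (v.symm.injective.injOn)
    rw [Fin.card_Ioo, Fin.card_Ioo] at hcard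
    have h1 := Fin.lt_def.mp hli
    have h2 := Fin.lt_def.mp hi
    omega
  · exact hli
  · -- `i < l`: the positions in `(i, j)` carry values in `(l, j)`
    exfalso
    have hmaps : ∀ q ∈ Finset.Ioo i j, v q ∈ Finset.Ioo l j := by
      intro q hq
      rw [Finset.mem_Ioo] at hq ⊢
      have hqj : v q ≠ l := fun e => hq.2.ne (v.injective (e.trans hlj))
      have hqi : v q ≠ j := fun e => hq.1.ne' (v.injective (e.trans hj))
      constructor
      · by_contra h
        have hvl : v q < l := lt_of_le_of_ne (not_lt.mp h) hqj
        exact not312_vals h312 hq.1 hq.2 ⟨by rw [← hlj]; exact Fin.lt_def.mp hvl, Fin.lt_def.mp hl⟩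
      · by_contra h
        have hjv : j < v q := lt_of_le_of_ne (not_lt.mp h) (Ne.symm hqi)
        exact not231_vals h231 hq.1 hq.2 ⟨Fin.lt_def.mp hl, by rw [← hj]; exact Fin.lt_def.mp hjv⟩
    have hcard := Finset.card_le_card_of_injOn (fun q => v q) hmaps (v.injective.injOn)
    rw [Fin.card_Ioo, Fin.card_Ioo] at hcard
    have h1 := Fin.lt_def.mp hli
    have h2 := Fin.lt_def.mp hl
    have h3 := Fin.lt_def.mp hi
    omega

/-- ★★ **Every permutation avoiding `231` and `312` is an involution**: `v (v i) = i` for all `i` (the case `v i < i`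
is the case `i' < v⁻¹ i'`, `i' = v i`, for `v⁻¹ ∈ S_n(231, 312)`).  With §1 this is the set equality of §3.
[cite: SimionSchmidt1985, Proposition 6 (proof) and Remarks (held text p0009–p0010)] -/
theorem apply_apply_eq_of_av231_av312 (h231 : ¬ PermContainsPattern v ![2, 3, 1])
    (h312 : ¬ PermContainsPattern v ![3, 1, 2]) (i : Fin n) : v (v i) = i := by
  rcases lt_trichotomy i (v i) with hi | hi | hi
  · exact apply_apply_eq_of_lt h231 h312 hi
  · rw [← hi, ← hi]
  · have h1 : ¬ PermContainsPattern v⁻¹ ![2, 3, 1] := by rwa [contains_231_inv_iff]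
    have h2 : ¬ PermContainsPattern v⁻¹ ![3, 1, 2] := by rwa [contains_312_inv_iff]
    have hlt : v i < v⁻¹ (v i) := by
      rw [Perm.coe_inv, Equiv.symm_apply_apply]
      exact hi
    have h := apply_apply_eq_of_lt h1 h2 hlt
    rw [Perm.coe_inv, Equiv.symm_apply_apply] at h
    -- `h : v.symm i = v i`
    have := congrArg v h
    rwa [Equiv.apply_symm_apply, eq_comm] at this

/-- ★★ `S_n(231, 312)` consists of involutions: `v * v = 1`.
[cite: SimionSchmidt1985, Proposition 6 (proof) and Remarks (held text p0009–p0010)] -/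
theorem mul_self_eq_one_of_av231_av312 (h231 : ¬ PermContainsPattern v ![2, 3, 1])
    (h312 : ¬ PermContainsPattern v ![3, 1, 2]) : v * v = 1 :=
  Equiv.ext fun i => by
    rw [Perm.mul_apply, Perm.one_apply]
    exact apply_apply_eq_of_av231_av312 h231 h312 i

/-- The same with `v ^ 2 = 1`. [cite: SimionSchmidt1985, Proposition 6 (proof) and Remarks (held text p0009–p0010)] -/
theorem sq_eq_one_of_av231_av312 (h231 : ¬ PermContainsPattern v ![2, 3, 1])
    (h312 : ¬ PermContainsPattern v ![3, 1, 2]) : v ^ 2 = 1 := by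
  rw [sq, mul_self_eq_one_of_av231_av312 h231 h312]

/-- In `S_n(231, 312)`, `i < v i` forces the positions strictly between `i` and `v i` to carry exactly the values strictly
between `i` and `v i` («the integers from `i` to `σ(i) − 1`», (4) of the printed proof): `i < q < v i → i < v q < v i`.
[cite: SimionSchmidt1985, Proposition 6 (proof, (4)) (held text p0009)] -/
theorem apply_mem_Ioo_of_av231_av312 (h231 : ¬ PermContainsPattern v ![2, 3, 1])
    (h312 : ¬ PermContainsPattern v ![3, 1, 2]) {i q : Fin n} (hiq : i < q) (hqj : q < v i) :
    i < v q ∧ v q < v i := by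
  have hji : v (v i) = i := apply_apply_eq_of_av231_av312 h231 h312 i
  have hqi : v q ≠ i := fun e => hqj.ne (v.injective (e.trans hji.symm))
  have hqj' : v q ≠ v i := fun e => hiq.ne' (v.injective e)
  constructor
  · by_contra h
    have hvl : v q < i := lt_of_le_of_ne (not_lt.mp h) hqi
    exact not312_vals h312 hiq hqj ⟨by rw [hji]; exact Fin.lt_def.mp hvl, by rw [hji]; exact Fin.lt_def.mp (hiq.trans hqj)⟩
  · by_contra h
    have hjv : v i < v q := lt_of_le_of_ne (not_lt.mp h) (Ne.symm hqj')
    exact not231_vals h231 hiq hqj ⟨by rw [hji]; exact Fin.lt_def.mp (hiq.trans hqj), Fin.lt_def.mp hjv⟩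

/-- … and decreasingly («decreasingly ordered», (3)–(4) of the printed proof): for `i ≤ p < q ≤ v i`, `v q < v p`.
[cite: SimionSchmidt1985, Proposition 6 (proof, (3)–(4)) (held text p0009)] -/
theorem apply_lt_apply_of_av231_av312 (h231 : ¬ PermContainsPattern v ![2, 3, 1])
    (h312 : ¬ PermContainsPattern v ![3, 1, 2]) {i p q : Fin n} (hip : i ≤ p) (hpq : p < q) (hqj : q ≤ v i) :
    v q < v p := by
  have hji : v (v i) = i := apply_apply_eq_of_av231_av312 h231 h312 i
  rcases hip.eq_or_lt with rfl | hip'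
  · -- `p = i`
    rcases hqj.eq_or_lt with rfl | hqj'
    · rw [hji]; exact hpq
    · exact (apply_mem_Ioo_of_av231_av312 h231 h312 hpq hqj').2
  · rcases hqj.eq_or_lt with rfl | hqj'
    · rw [hji]; exact (apply_mem_Ioo_of_av231_av312 h231 h312 hip' hpq).1
    · -- `i < p < q < v i`: an ascent `v p < v q` would be a `312` at `(i, p, q)`
      by_contra h
      have hpq' : v p < v q := lt_of_le_of_ne (not_lt.mp h) (fun e => hpq.ne (v.injective e))
      exact not312_vals h312 hip' hpq
        ⟨Fin.lt_def.mp hpq', Fin.lt_def.mp (apply_mem_Ioo_of_av231_av312 h231 h312 (hip'.trans hpq) hqj').2⟩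

end Structure

/-! ### §3 PROPOSITION 6 and the REMARK: `I_n(231) = I_n(312) = A_n(231, 312) = 2^{n−1}` -/

/-- ★ The `231`-avoiding involutions are exactly the permutations avoiding `231` and `312`.
[cite: SimionSchmidt1985, Proposition 6 and Remarks (held text p0009–p0010)] -/
theorem involution_and_av231_iff (v : Perm (Fin n)) :
    (v * v = 1 ∧ ¬ PermContainsPattern v ![2, 3, 1]) ↔
      (¬ PermContainsPattern v ![2, 3, 1] ∧ ¬ PermContainsPattern v ![3, 1, 2]) :=
  ⟨fun h => ⟨h.2, not_contains_312_of_involution h.1 h.2⟩, fun h => ⟨mul_self_eq_one_of_av231_av312 h.1 h.2, h.1⟩⟩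

/-- ★ The `312`-avoiding involutions are exactly the permutations avoiding `231` and `312`.
[cite: SimionSchmidt1985, Proposition 6 and Remarks (held text p0009–p0010)] -/
theorem involution_and_av312_iff (v : Perm (Fin n)) :
    (v * v = 1 ∧ ¬ PermContainsPattern v ![3, 1, 2]) ↔
      (¬ PermContainsPattern v ![2, 3, 1] ∧ ¬ PermContainsPattern v ![3, 1, 2]) :=
  ⟨fun h => ⟨not_contains_231_of_involution h.1 h.2, h.2⟩, fun h => ⟨mul_self_eq_one_of_av231_av312 h.1 h.2, h.2⟩⟩

/-- ★ **REMARK** «`312`- and `231`-avoiding involutions are not only equal in number, but they are equal as sets».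
[cite: SimionSchmidt1985, §2 Remarks after Proposition 6 (held text p0010)] -/
theorem involution_and_av231_iff_involution_and_av312 (v : Perm (Fin n)) :
    (v * v = 1 ∧ ¬ PermContainsPattern v ![2, 3, 1]) ↔ (v * v = 1 ∧ ¬ PermContainsPattern v ![3, 1, 2]) := by
  rw [involution_and_av231_iff, involution_and_av312_iff]

/-- The REMARK as an equality of sets of permutations. [cite: SimionSchmidt1985, §2 Remarks after Proposition 6 (held text p0010)] -/
theorem setOf_involution_av231_eq_setOf_involution_av312 (n : ℕ) :
    {v : Perm (Fin n) | v * v = 1 ∧ ¬ PermContainsPattern v ![2, 3, 1]} =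
      {v : Perm (Fin n) | v * v = 1 ∧ ¬ PermContainsPattern v ![3, 1, 2]} :=
  Set.ext fun v => involution_and_av231_iff_involution_and_av312 v

/-- `{231-avoiding involutions} = S_n(231, 312)` as sets. [cite: SimionSchmidt1985, Proposition 6 and Remarks (held text p0009–p0010)] -/
theorem setOf_involution_av231_eq (n : ℕ) :
    {v : Perm (Fin n) | v * v = 1 ∧ ¬ PermContainsPattern v ![2, 3, 1]} =
      {v : Perm (Fin n) | ¬ PermContainsPattern v ![2, 3, 1] ∧ ¬ PermContainsPattern v ![3, 1, 2]} :=
  Set.ext fun v => involution_and_av231_iff v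

/-- ★★★ **PROPOSITION 6 (Simion–Schmidt 1985)** «For every `n ≥ 1`, and `p ∈ {231, 312}`, `I_n(p) = 2^{n−1}`», the
case `p = 231`: the number of `231`-avoiding involutions of length `n` is `2^{n−1}` (for `n = 0` both sides read `1`).
Proof: they are the elements of `S_n(231, 312)`, counted by Proposition 8 / Lemma 5 (b) (`card_av231_av312`).
[cite: SimionSchmidt1985, Proposition 6 (held text p0009)] -/
theorem card_involutions_av231 (n : ℕ) :
    Nat.card {v : Perm (Fin n) // v * v = 1 ∧ ¬ PermContainsPattern v ![2, 3, 1]} = 2 ^ (n - 1) := by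
  rw [Nat.card_congr (Equiv.subtypeEquivRight (fun v => involution_and_av231_iff v)), card_av231_av312]

/-- ★★★ **PROPOSITION 6**, the case `p = 312`: the number of `312`-avoiding involutions of length `n` is `2^{n−1}`.
[cite: SimionSchmidt1985, Proposition 6 (held text p0009)] -/
theorem card_involutions_av312 (n : ℕ) :
    Nat.card {v : Perm (Fin n) // v * v = 1 ∧ ¬ PermContainsPattern v ![3, 1, 2]} = 2 ^ (n - 1) := by
  rw [Nat.card_congr (Equiv.subtypeEquivRight (fun v => involution_and_av312_iff v)), card_av231_av312]

/-- PROPOSITION 6 with involutions written `v ^ 2 = 1`. [cite: SimionSchmidt1985, Proposition 6 (held text p0009)] -/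
theorem card_involutions_av231_sq (n : ℕ) :
    Nat.card {v : Perm (Fin n) // v ^ 2 = 1 ∧ ¬ PermContainsPattern v ![2, 3, 1]} = 2 ^ (n - 1) := by
  simp_rw [sq]
  exact card_involutions_av231 n

/-- PROPOSITION 6 (`p = 312`) with `v ^ 2 = 1`. [cite: SimionSchmidt1985, Proposition 6 (held text p0009)] -/
theorem card_involutions_av312_sq (n : ℕ) :
    Nat.card {v : Perm (Fin n) // v ^ 2 = 1 ∧ ¬ PermContainsPattern v ![3, 1, 2]} = 2 ^ (n - 1) := by
  simp_rw [sq]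
  exact card_involutions_av312 n

/-- The involutions avoiding both `231` and `312` — the same set once more — also number `2^{n−1}`.
[cite: SimionSchmidt1985, Proposition 6 and Remarks (held text p0009–p0010)] -/
theorem card_involutions_av231_av312 (n : ℕ) :
    Nat.card {v : Perm (Fin n) // v * v = 1 ∧ ¬ PermContainsPattern v ![2, 3, 1] ∧ ¬ PermContainsPattern v ![3, 1, 2]} =
      2 ^ (n - 1) := by
  rw [Nat.card_congr (Equiv.subtypeEquivRight (fun v => ?_)), card_av231_av312 n]
  exact ⟨fun h => h.2, fun h => ⟨mul_self_eq_one_of_av231_av312 h.1 h.2, h⟩⟩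

/-- Sanity value «`n = 3`»: the four `231`-avoiding involutions of length `3` are `123, 132, 213, 321` — `I_3(231) = 4
= 2²`. [cite: SimionSchmidt1985, Proposition 6 (held text p0009)] -/
theorem card_involutions_av231_three :
    Nat.card {v : Perm (Fin 3) // v * v = 1 ∧ ¬ PermContainsPattern v ![2, 3, 1]} = 4 := by
  rw [card_involutions_av231]; rfl

end PermContainsPattern

end Literature.Combinatorics.Enumerative
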